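import Summits.Parity.BatemanHorn.Theorems.BalancedSemiprimeLayer.Negative.TightAtX

/-!
# `BalancedSemiprimeLayer` (crux stmt-Parity-9469): four refuted natural strengthenings

Negative-side results (cdisprove, refuter-cdisprove-stmt-Parity-9469-g2-0), all PROVED; each
strengthening is false already at a LINEAR Bateman–Horn system, by the `(X)`-layer asymptotic
`(Φ(x, x^{(1−δ)/2}) − π(x))·log x/x → log((1+δ)/(1−δ))` (`tendsto_layer_X`):

* `not_cruxStrongTolerance` — the tolerance exponent `k` cannot be raised to `k + 1`
  (`… ≤ P_f(x) + ε·x/(log x)^{k+1}` is false at `(X)`);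
* `not_cruxUniformDelta` — `∃ δ ∀ ε` instead of `∀ ε ∃ δ` is false at `(X)` (take `ε = δ/2`): the
  layer must genuinely be thinned, `δ(ε) → 0`;
* `not_cruxQuarter` — the cap `δ = 1/4` itself does not serve every `ε` (false for `ε < log(5/3)`);
* `not_cruxCoordinatewise` — bounding, for EACH coordinate separately, the `n ≤ x` whose value
  `fᵢ(n)` is rough but not prime (the other coordinates unconstrained) by `ε·x/(log x)^k` is false for
  the twin system `(X, X+2)`: coordinate `X` alone has `≍ δ·x/log x` such `n` against the `k = 2`
  tolerance. The layer of a system is a JOINT `k`-dimensional sifting problem — every coordinate must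
  be kept rough (each contributes a factor `1/log x`), a union of one-dimensional bounds loses.
-/

namespace Summit.Parity.BatemanHorn.Theorems.BalancedSemiprimeLayer.Negative

open Filter Finset Polynomial Real
open scoped Topology
open Literature.NumberTheory.Sieve

/-! ### Strengthening 1: tolerance one logarithm smaller -/

/-- **Refuted**: `… ≤ P_f(x) + ε·x/(log x)^{k+1}` (witness `(X)`, `ε = 1`). [folklore] -/
theorem not_cruxStrongTolerance :
    ¬ ∀ (k : ℕ) (f : Fin k → ℤ[X]), IsBatemanHornSystem f → ∀ ε : ℝ, 0 < ε →
      ∃ δ : ℝ, 0 < δ ∧ δ ≤ 1 / 4 ∧ ∀ᶠ x : ℕ in atTop,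
        (((Icc 1 x).filter (fun n : ℕ => ∀ i, 0 < (f i).eval (n : ℤ) ∧
          ∀ p ∈ range ⌈(x : ℝ) ^ (((f i).natDegree : ℝ) * (1 - δ) / 2)⌉₊,
            p.Prime → ¬ ((p : ℤ) ∣ (f i).eval (n : ℤ)))).card : ℝ) ≤
          (polyPrimeCount f x : ℝ) + ε * (x : ℝ) / Real.log x ^ (k + 1) := by
  intro h
  obtain ⟨δ, hδ0, hδ, hev⟩ := h 1 ![X] isBatemanHornSystem_X 1 one_pos
  have hgt := eventually_mul_div_log_pow_lt (tendsto_layer_X hδ0.le hδ)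
    (log_ratio_pos hδ0 (by linarith)) 1 (le_refl 2)
  obtain ⟨x, h1, h2⟩ := (hev.and hgt).exists
  rw [card_cruxFilter_X, polyPrimeCount_X] at h1
  norm_num at h1 h2
  linarith

/-! ### Strengthening 2: one `δ` for all `ε` -/

/-- **Refuted**: `∃ δ ∀ ε` (witness `(X)`, `ε = δ/2 < log((1+δ)/(1−δ))`). [folklore] -/
theorem not_cruxUniformDelta :
    ¬ ∀ (k : ℕ) (f : Fin k → ℤ[X]), IsBatemanHornSystem f → ∃ δ : ℝ, 0 < δ ∧ δ ≤ 1 / 4 ∧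
      ∀ ε : ℝ, 0 < ε → ∀ᶠ x : ℕ in atTop,
        (((Icc 1 x).filter (fun n : ℕ => ∀ i, 0 < (f i).eval (n : ℤ) ∧
          ∀ p ∈ range ⌈(x : ℝ) ^ (((f i).natDegree : ℝ) * (1 - δ) / 2)⌉₊,
            p.Prime → ¬ ((p : ℤ) ∣ (f i).eval (n : ℤ)))).card : ℝ) ≤
          (polyPrimeCount f x : ℝ) + ε * (x : ℝ) / Real.log x ^ k := by
  intro h
  obtain ⟨δ, hδ0, hδ, hev⟩ := h 1 ![X] isBatemanHornSystem_X
  have hlog : δ ≤ Real.log ((1 + δ) / (1 - δ)) := delta_le_log_ratio hδ0.le (by linarith)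
  have h1 := hev (δ / 2) (by linarith)
  have h2 := layer_X_eventually_gt hδ0.le hδ (show δ / 2 < Real.log ((1 + δ) / (1 - δ)) by linarith)
  obtain ⟨x, hx1, hx2⟩ := (h1.and h2).exists
  rw [card_cruxFilter_X, polyPrimeCount_X, pow_one] at hx1
  linarith

/-! ### Strengthening 3: the cap `δ = 1/4` for every `ε` -/

/-- **Refuted**: `δ = 1/4` does not serve `ε = 1/8 < 1/4 ≤ log(5/3)` at `(X)`. [folklore] -/
theorem not_cruxQuarter :
    ¬ ∀ (k : ℕ) (f : Fin k → ℤ[X]), IsBatemanHornSystem f → ∀ ε : ℝ, 0 < ε → ∀ᶠ x : ℕ in atTop,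
      (((Icc 1 x).filter (fun n : ℕ => ∀ i, 0 < (f i).eval (n : ℤ) ∧
        ∀ p ∈ range ⌈(x : ℝ) ^ (((f i).natDegree : ℝ) * (1 - 1 / 4) / 2)⌉₊,
          p.Prime → ¬ ((p : ℤ) ∣ (f i).eval (n : ℤ)))).card : ℝ) ≤
        (polyPrimeCount f x : ℝ) + ε * (x : ℝ) / Real.log x ^ k := by
  intro h
  have h1 := h 1 ![X] isBatemanHornSystem_X (1 / 8) (by norm_num)
  have hlog : (1 : ℝ) / 4 ≤ Real.log ((1 + 1 / 4) / (1 - 1 / 4)) :=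
    delta_le_log_ratio (by norm_num) (by norm_num)
  have h2 := layer_X_eventually_gt (le_of_lt (by norm_num : (0 : ℝ) < 1 / 4)) le_rfl
    (show (1 : ℝ) / 8 < Real.log ((1 + 1 / 4) / (1 - 1 / 4)) by linarith)
  obtain ⟨x, hx1, hx2⟩ := (h1.and h2).exists
  rw [card_cruxFilter_X, polyPrimeCount_X, pow_one] at hx1
  linarith

/-! ### Strengthening 4: the coordinatewise (naive union) bound -/

/-- `ω_{(X, X+2)}(p) < p`: the residues are `n ≡ 0, −2`. [folklore] -/
theorem polyRootCountMod_twin_lt {p : ℕ} (hp : p.Prime) :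
    polyRootCountMod ![(X : ℤ[X]), X + C 2] p < p := by
  unfold polyRootCountMod
  have hsub : (range p).filter (fun n : ℕ => (p : ℤ) ∣ ∏ i, (![(X : ℤ[X]), X + C 2] i).eval (n : ℤ))
      ⊆ {0, p - 2} := by
    intro n hn
    simp only [mem_filter, mem_range, Fin.prod_univ_two, Matrix.cons_val_zero, Matrix.cons_val_one,
      eval_X, eval_add, eval_C] at hn
    obtain ⟨hnp, hdvd⟩ := hn
    rw [mem_insert, mem_singleton]
    have hP := Nat.prime_iff_prime_int.mp hp
    rcases hP.dvd_or_dvd hdvd with h1 | h2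
    · left
      exact Nat.eq_zero_of_dvd_of_lt (Int.natCast_dvd_natCast.mp h1) hnp
    · right
      have h2' : p ∣ n + 2 := by exact_mod_cast h2
      obtain ⟨c, hc⟩ := h2'
      have hp2 := hp.two_le
      have hc1 : c = 1 := by
        rcases Nat.lt_or_ge c 2 with hc2 | hc2
        · interval_cases c
          · omega
          · rfl
        · have : p * 2 ≤ p * c := Nat.mul_le_mul_left p hc2
          omega
      subst hc1
      omega
  refine lt_of_le_of_lt (card_le_card hsub) ?_
  rcases hp.eq_two_or_odd' with rfl | hodd
  · simp
  · have hp3 : 3 ≤ p := by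
      rcases hp.two_le.eq_or_lt with h | h
      · exfalso
        rw [← h] at hodd
        exact (by decide : ¬ Odd 2) hodd
      · omega
    calc #({0, p - 2} : Finset ℕ) ≤ 2 := Finset.card_le_two
      _ < p := by omega

/-- The twin system `(X, X + 2)` is a Bateman–Horn system. [folklore] -/
theorem isBatemanHornSystem_twin : IsBatemanHornSystem ![(X : ℤ[X]), X + C 2] where
  irreducible i := by
    fin_cases i
    · exact irreducible_X
    · show Irreducible (X + C (2 : ℤ))
      have h : (X + C (2 : ℤ) : ℤ[X]) = X - C (-2) := by
        rw [C_neg, sub_neg_eq_add]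
      rw [h]
      exact irreducible_X_sub_C (-2)
  leadingCoeff_pos i := by
    fin_cases i
    · show 0 < (X : ℤ[X]).leadingCoeff
      rw [leadingCoeff_X]; norm_num
    · show 0 < (X + C (2 : ℤ)).leadingCoeff
      rw [leadingCoeff_X_add_C]; norm_num
  pairwise_not_associated i j hij := by
    have hnd : ¬ ((X : ℤ[X]) ∣ X + C 2) := by
      rw [X_dvd_iff]
      simp
    fin_cases i <;> fin_cases j
    · exact absurd rfl hij
    · exact fun h => hnd h.dvd
    · exact fun h => hnd h.symm.dvd
    · exact absurd rfl hij
  hasNoFixedPrimeDivisor p hp := polyRootCountMod_twin_lt hp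

/-- `Φ(x, N) ≤ #S + π(x)` for any finset `S` containing the non-prime `N`-rough `n ∈ [1, x]`.
[folklore] -/
theorem card_roughIcc_le_card_add_primeCounting {N x : ℕ} {S : Finset ℕ}
    (hS : ∀ n ∈ roughIcc N x, ¬ n.Prime → n ∈ S) :
    #(roughIcc N x) ≤ #S + Nat.primeCounting x := by
  have hπ : #((Icc 1 x).filter Nat.Prime) ≤ Nat.primeCounting x := by
    rw [← Nat.primesLE_card_eq_primeCounting, Nat.primesLE_eq_filter_range]
    refine card_le_card fun n hn => ?_
    simp only [mem_filter, mem_Icc, mem_range] at hn ⊢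
    exact ⟨by omega, hn.2⟩
  have hsub : roughIcc N x \ (Icc 1 x).filter Nat.Prime ⊆ S := by
    intro n hn
    obtain ⟨hn1, hn2⟩ := Finset.mem_sdiff.mp hn
    refine hS n hn1 fun hpr => hn2 ?_
    simp only [mem_filter]
    exact ⟨roughIcc_subset_Icc N x hn1, hpr⟩
  calc #(roughIcc N x) ≤ #(roughIcc N x \ (Icc 1 x).filter Nat.Prime) + #((Icc 1 x).filter Nat.Prime) :=
        card_le_card_sdiff_add_card
    _ ≤ _ := add_le_add (card_le_card hsub) hπ

/-- **Refuted**: the coordinatewise bound (witness `(X, X+2)`, coordinate `X`, `ε = 1`). [folklore] -/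
theorem not_cruxCoordinatewise :
    ¬ ∀ (k : ℕ) (f : Fin k → ℤ[X]), IsBatemanHornSystem f → ∀ ε : ℝ, 0 < ε →
      ∃ δ : ℝ, 0 < δ ∧ δ ≤ 1 / 4 ∧ ∀ᶠ x : ℕ in atTop, ∀ i,
        (((Icc 1 x).filter (fun n : ℕ => 0 < (f i).eval (n : ℤ) ∧
          (∀ p ∈ range ⌈(x : ℝ) ^ (((f i).natDegree : ℝ) * (1 - δ) / 2)⌉₊,
            p.Prime → ¬ ((p : ℤ) ∣ (f i).eval (n : ℤ))) ∧
          ¬ ((f i).eval (n : ℤ)).toNat.Prime)).card : ℝ) ≤ ε * (x : ℝ) / Real.log x ^ k := by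
  intro h
  obtain ⟨δ, hδ0, hδ, hev⟩ := h 2 ![X, X + C 2] isBatemanHornSystem_twin 1 one_pos
  have hgt := eventually_mul_div_log_pow_lt (tendsto_layer_X hδ0.le hδ)
    (log_ratio_pos hδ0 (by linarith)) 1 (le_refl 2)
  obtain ⟨x, h1, h2⟩ := (hev.and hgt).exists
  -- name the coordinate-`0` finset WITHOUT restating it
  obtain ⟨S, hS, h1'⟩ : ∃ S : Finset ℕ, S = _ ∧ ((#S : ℕ) : ℝ) ≤ 1 * (x : ℝ) / Real.log x ^ 2 :=
    ⟨_, rfl, h1 0⟩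
  have h3 : #(roughIcc ⌈(x : ℝ) ^ ((1 - δ) / 2)⌉₊ x) ≤ #S + Nat.primeCounting x := by
    refine card_roughIcc_le_card_add_primeCounting fun n hn hnp => ?_
    rw [mem_roughIcc] at hn
    rw [hS]
    simp only [mem_filter, mem_Icc, Matrix.cons_val_zero, eval_X, natDegree_X, Nat.cast_one, one_mul,
      Int.toNat_natCast, mem_range]
    refine ⟨hn.1, by exact_mod_cast hn.1.1, fun p hp hpp hdvd => ?_, hnp⟩
    exact absurd (hn.2 p hpp (Int.natCast_dvd_natCast.mp hdvd)) (not_le.mpr hp)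
  have h3' : (#(roughIcc ⌈(x : ℝ) ^ ((1 - δ) / 2)⌉₊ x) : ℝ) ≤ (#S : ℝ) + (Nat.primeCounting x : ℝ) := by
    exact_mod_cast h3
  linarith

end Summit.Parity.BatemanHorn.Theorems.BalancedSemiprimeLayer.Negative
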